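import Summits.ResolutionOfSingularities.ResolutionOfSingularities.Theses.WeightedInvariant

/-!
# cstrat-p1 (wall-breaker) — typed negative target from STRATEGY-CENSUS.md §2.4

`OneRootRobustAtFixedLevel p` is the UP-direction analogue of the dead core F″: "if a normal integral
`X/k` has a resolution, then it has one that STAYS regular after adjoining one p-th root of a constant".
It is NOT implied by the crux (the crux resolves `X ⊗ K` over `K`, it does not descend that resolution
to `k`), and it is FALSE for every prime `p` (on paper, census §2.4): `k ∌ w`, `μ := w^p ∈ k`,
`X := {y z = (x^p - μ)^2} ⊂ 𝔸³_k` is a normal surface whose minimal resolution `Bl_P X` has the chart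
`k[x,y,a]/(x^p - μ - y a)`, regular and non-smooth at `(x^p - μ, y, a)`, whose base change to
`K = k(w)` is `K[v,y,a]/(v^p - y a)` (an `A_{p-1}` point); every resolution of the excellent surface
`X` dominates the minimal one, so none is robust. A disprover can land `¬ OneRootRobustAtFixedLevel p`
under `Theorems/DescentPerfectToAll/Negative/` once minimal-resolution domination for excellent
surfaces is available; the ring-level half is the pattern of
`Literature.Barriers.ResolutionOfSingularities.RegularNotGeometricallyRegular`.
-/

open AlgebraicGeometry CategoryTheory CategoryTheory.Limits
open Literature.AlgebraicGeometry.Resolution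

namespace Summit.ResolutionOfSingularities.ResolutionOfSingularities.Cruxes.DescentPerfectToAll.Strategist

/-- UP-direction one-root robustness at a FIXED level (census §2.4): false for every prime. -/
def OneRootRobustAtFixedLevel (p : ℕ) : Prop :=
  ∀ (k K : Type) [Field k] [Field K] [Algebra k K] [CharP k p] (a : k) (α : K),
    (∀ b : k, b ^ p ≠ a) → α ^ p = algebraMap k K a → IntermediateField.adjoin k {α} = ⊤ →
    ∀ (X : Scheme.{0}) (f : X ⟶ Spec (.of k)), IsSeparated f → LocallyOfFiniteType f →
      QuasiCompact f → IsIntegral X → (∀ x : X, IsIntegrallyClosed (X.presheaf.stalk x)) →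
      Scheme.HasResolution X →
        ∃ (Y : Scheme.{0}) (π : Y ⟶ X), IsProper π ∧ IsBirational π ∧ Scheme.IsRegular Y ∧
          Scheme.IsRegular (pullback (π ≫ f) (Spec.map (CommRingCat.ofHom (algebraMap k K))))

/-- Sanity: the crux's hypothesis shape is untouched — `OneRootRobustAtFixedLevel` would give the
one-root step F″ "for free" only together with descent of regularity along the faithfully flat
`Y ⊗ K → Y`, which is the trivial direction; recorded to make the logical position explicit. -/
theorem oneRootRobust_gives_regular_downstairs (p : ℕ) (h : OneRootRobustAtFixedLevel p)
    (k K : Type) [Field k] [Field K] [Algebra k K] [CharP k p] (a : k) (α : K)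
    (ha : ∀ b : k, b ^ p ≠ a) (hα : α ^ p = algebraMap k K a) (htop : IntermediateField.adjoin k {α} = ⊤)
    (X : Scheme.{0}) (f : X ⟶ Spec (.of k)) [IsSeparated f] [LocallyOfFiniteType f] [QuasiCompact f]
    [IsIntegral X] (hn : ∀ x : X, IsIntegrallyClosed (X.presheaf.stalk x))
    (hX : Scheme.HasResolution X) : Scheme.HasResolution X := by
  obtain ⟨Y, π, hp, hb, hr, -⟩ := h k K a α ha hα htop X f ‹_› ‹_› ‹_› ‹_› hn hX
  exact ⟨Y, π, hp, hb, hr⟩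

end Summit.ResolutionOfSingularities.ResolutionOfSingularities.Cruxes.DescentPerfectToAll.Strategist
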